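import Summits.QuantumFields.YangMills.Theorems.FluctuationComparisonRegPrIntLS2BetaExcessSplit
import Literature.MathematicalPhysics.QuantumFieldTheory.Balaban1983to89.B15Prop1ChartCalculusSU2
import Literature.MathematicalPhysics.QuantumFieldTheory.Balaban1983to89.T4WilsonLinkAffine
import HarnessLib

/-!
# S2β ∕ GAP♯∘ strata residue (H′) — THE TANGENT SPLIT (T♮) OF THE PAIRING, PROVED:
# `|LIN(U;U₀) − DA(U₀)[ξ(U,U₀)]| ≤ 20·d·θ₀·Σ_ℓ dist1(U ℓ·(U₀ ℓ)⁻¹)²` with `DA(U₀)` the EXPLICIT first variation in right-invariant coordinates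

Cell `ym3-torus` (YM ladder rung R3 = continuum `SU(2)` Yang–Mills on the three-torus — a RUNG: NOT d = 4, NOT infinite volume,
NOT a mass gap, NOT Clay).  Width seat «width 16» `ym3-torus-px16` (gen 21), FREE px helper on crux `stmt-QuantumFields-20520`
(`FluctuationComparisonRegPrIntL`), count-neutral, DEFINITION-FREE, default heartbeats.

WHAT.  The first of the four sub-letters of the pairing letter (F♮) (UV3-NODE §75.8 (3); door ✓∕⧗`…S2BetaPairingOfTangentLetters`) is
PROVED here outright, for any `Params`, any level and ANY pair of configurations — it is pure `SU(2)` kinematics: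
with `B_ℓ := U ℓ·(U₀ ℓ)⁻¹` (right-invariant relative bond variables), `ξ_ℓ := imVec q(B_ℓ) ∈ ℝ³` (the chart vector), `E_p := U₀(∂p)⁻¹·U(∂p)`
and `a_p := imVec q(U₀(∂p))` (`‖a_p‖ ≤ dist1 U₀(∂p) ≤ θ₀`):
§1–§2 quaternion bookkeeping (`imVec` additive; `imVec q(TBT⁻¹) = Ad_T imVec q(B)` via lit ✓`adSU2`; `imVec q(B⁻¹) = −imVec q(B)`;
★`norm_fourFactor_rem_le`: `‖F₁F₂F₃F₄ − 1 − Σ(F_i − 1)‖ ≤ 5·Σ‖F_i − 1‖²` from the exact `XY − 1 − (X−1) − (Y−1) = (X−1)(Y−1)`);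
§3 `rel_plaqHol_eq_fourFactor`: EXACT `E_p = (T₁B₁T₁⁻¹)(T₂B₂T₂⁻¹)(T₃B₃⁻¹T₃⁻¹)B₄⁻¹` with the partial transporters `T₁ = U₀(∂p)⁻¹`, `T₂ = T₁U₀(ℓ₁)`,
`T₃ = T₂U₀(ℓ₂)U₀(ℓ₃)⁻¹` on the bonds `ℓ₁ = ⟨x,μ⟩, ℓ₂ = ⟨x+e_μ,ν⟩, ℓ₃ = ⟨x+e_ν,μ⟩, ℓ₄ = ⟨x,ν⟩`; ★`norm_imVec_rel_sub_lin_le`: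
`‖imVec q(E_p) − L_p(ξ)‖ ≤ 5·Σ_{i≤4} dist1(B_{ℓ_i})²`, `L_p(ξ) = Ad_{T₁}ξ_{ℓ₁} + Ad_{T₂}ξ_{ℓ₂} − Ad_{T₃}ξ_{ℓ₃} − ξ_{ℓ₄}` (CHORD currency, no smallness
of the pair); ★`abs_inner_rel_sub_inner_lin_le` (weight `θ₀` from `a_p`); §4 slot double counting (`card_slot₁…₄_le`: fibres `≤ d`; `sum_slots_le`);
§5 ★★★ `tangentSplit`: **`|Σ_p ⟪a_p, imVec q(E_p)⟫ − DA(U₀)[ξ]| ≤ 20·d·θ₀·Σ_ℓ dist1(B_ℓ)²`**, `DA(U₀) := ζ ↦ Σ_p ⟪a_p, L_p(ζ)⟫` an explicit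
function applied to `ζ := ξ` — the (T♮) conjunct of ✓∕⧗`pairingLetter_of_tangentLetters` with `C_T := 20·d` (`DA(U₀)` IS the differential of the
Wilson action at `U₀` in the right-invariant chart: `d∕dt (1 − reTr P_t) = ⟪a_p, imVec q(Ė_p)⟫`).

HONEST SCOPE.  Kinematics of the tree's `SU(2)` chart and finite counting; (T♮) is thereby a THEOREM (no hypothesis); the other sub-letters
CRIT-m♮ ∕ MULT♮ ∕ AVG₂♮ ∕ BKG, the letters (D♮)∕(F♮), `hIrr`∕`hA`, GAP♯∘ (`stub_uniformFibreGapOrbit`), S2β, the five registered stubs of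
`Lines/semiclassical_s2beta.lean` (3732b7df), crux 20520, 19936, 19200 and `YM3TorusSU2` are NOT proved; nothing of Bałaban's renormalisation
analysis is asserted; no registered stub is closed; the Yang–Mills mass gap is NOT proved.  Sorry-free, axioms standard.

References: T. Bałaban, CMP **102** (1985) 277–309 [Balaban1985Variational] ((34) p.283: expansion of plaquette variables about a background;
Thm 1 (9) p.279); CMP **122** (1989) 175–202 [Balaban1989LargeFieldI] ((1.77) p.194: the adjoint action); CMP **98** (1985) 17–51
[Balaban1985Averaging] ((5), (9) pp.18–19: bonds and plaquette variables).
-/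

set_option autoImplicit false

noncomputable section

open scoped Quaternion RealInnerProductSpace
open Finset
open Literature.MathematicalPhysics.QuantumLattice (su2Quat norm_su2Quat su2Quat_ne_zero)
open Literature.MathematicalPhysics.QuantumFieldTheory.Balaban1983to89
open Literature.MathematicalPhysics.QuantumFieldTheory.Balaban1983to89.T4CubeChartGnomonic (SU2)
open Literature.MathematicalPhysics.QuantumFieldTheory.Balaban1983to89.T4HaarSU2ExpChart (imQuat imQuat_re)
open Literature.MathematicalPhysics.QuantumFieldTheory.Balaban1983to89.T4HaarSU2Translate (su2Quat_mul su2Quat_one)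
open Literature.MathematicalPhysics.QuantumFieldTheory.Balaban1983to89.T4ExpWindowSmallField (imVec imQuat_imVec norm_imVec_sq
  dist1_eq_norm_su2Quat_sub_one)
open Literature.MathematicalPhysics.QuantumFieldTheory.Balaban1983to89.B15Prop1ChartSU2 (adSU2 adSU2_apply)
open Literature.MathematicalPhysics.QuantumFieldTheory.Balaban1983to89.B15Prop1ChartCalculusSU2 (imVecL imVecL_apply imVec_imQuat
  adSU2_one_apply)

namespace Summit.QuantumFields.YangMills.Theorems.FluctuationComparisonRegPrIntLS2BetaPairingTangentSplit

/-! ## §1 Quaternion bookkeeping: `imVec` is linear and short; the four-factor second-order remainder -/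

/-- `imVec` is additive. [folklore] -/
theorem imVec_add (p q : ℍ) : imVec (p + q) = imVec p + imVec q := map_add imVecL p q

/-- `imVec 1 = 0`. [folklore] -/
theorem imVec_one : imVec (1 : ℍ) = 0 := by
  ext i
  fin_cases i <;> simp [imVec]

/-- `imVec` of a real quaternion vanishes. [folklore] -/
theorem imVec_coe (r : ℝ) : imVec (r : ℍ) = 0 := by
  ext i
  fin_cases i <;> simp [imVec]

/-- **THE FOUR-FACTOR SECOND-ORDER REMAINDER** (any normed ring, factors within `2` of `1`):
`‖F₁F₂F₃F₄ − 1 − Σ_i (F_i − 1)‖ ≤ 5·Σ_i ‖F_i − 1‖²` — from the exact two-factor identity `XY − 1 − (X−1) − (Y−1) = (X−1)(Y−1)` applied to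
`(F₁F₂)(F₃F₄)`, with `‖F_i − 1‖ ≤ 2` used once to keep every product quadratic. [folklore] -/
theorem norm_fourFactor_rem_le {A : Type*} [NormedRing A] [NormOneClass A] (F₁ F₂ F₃ F₄ : A)
    (h₁ : ‖F₁ - 1‖ ≤ 2) (h₂ : ‖F₂ - 1‖ ≤ 2) (h₃ : ‖F₃ - 1‖ ≤ 2) (h₄ : ‖F₄ - 1‖ ≤ 2) :
    ‖F₁ * F₂ * F₃ * F₄ - 1 - ((F₁ - 1) + (F₂ - 1) + (F₃ - 1) + (F₄ - 1))‖ ≤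
      5 * (‖F₁ - 1‖ ^ 2 + ‖F₂ - 1‖ ^ 2 + ‖F₃ - 1‖ ^ 2 + ‖F₄ - 1‖ ^ 2) := by
  set D₁ := F₁ - 1 with hD₁
  set D₂ := F₂ - 1 with hD₂
  set D₃ := F₃ - 1 with hD₃
  set D₄ := F₄ - 1 with hD₄
  have hF₁ : F₁ = 1 + D₁ := by rw [hD₁]; abel
  have hF₂ : F₂ = 1 + D₂ := by rw [hD₂]; abel
  have hF₃ : F₃ = 1 + D₃ := by rw [hD₃]; abel
  have hF₄ : F₄ = 1 + D₄ := by rw [hD₄]; abel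
  have hid : F₁ * F₂ * F₃ * F₄ - 1 - (D₁ + D₂ + D₃ + D₄) =
      D₁ * D₂ + D₃ * D₄ + (D₁ + D₂ + D₁ * D₂) * (D₃ + D₄ + D₃ * D₄) := by
    rw [hF₁, hF₂, hF₃, hF₄]; noncomm_ring
  rw [hid]
  have n₁ := norm_nonneg D₁; have n₂ := norm_nonneg D₂; have n₃ := norm_nonneg D₃; have n₄ := norm_nonneg D₄
  have hG : ‖D₁ + D₂ + D₁ * D₂‖ ≤ 2 * (‖D₁‖ + ‖D₂‖) := by
    refine (norm_add_le _ _).trans ?_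
    refine (add_le_add (norm_add_le _ _) (norm_mul_le _ _)).trans ?_
    nlinarith [mul_le_mul_of_nonneg_left h₂ n₁, mul_le_mul_of_nonneg_right h₁ n₂]
  have hH : ‖D₃ + D₄ + D₃ * D₄‖ ≤ 2 * (‖D₃‖ + ‖D₄‖) := by
    refine (norm_add_le _ _).trans ?_
    refine (add_le_add (norm_add_le _ _) (norm_mul_le _ _)).trans ?_
    nlinarith [mul_le_mul_of_nonneg_left h₄ n₃, mul_le_mul_of_nonneg_right h₃ n₄]
  calc ‖D₁ * D₂ + D₃ * D₄ + (D₁ + D₂ + D₁ * D₂) * (D₃ + D₄ + D₃ * D₄)‖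
      ≤ ‖D₁‖ * ‖D₂‖ + ‖D₃‖ * ‖D₄‖ + 2 * (‖D₁‖ + ‖D₂‖) * (2 * (‖D₃‖ + ‖D₄‖)) := by
        refine (norm_add_le _ _).trans (add_le_add ((norm_add_le _ _).trans (add_le_add (norm_mul_le _ _) (norm_mul_le _ _))) ?_)
        exact (norm_mul_le _ _).trans (mul_le_mul hG hH (norm_nonneg _) (by positivity))
    _ ≤ 5 * (‖D₁‖ ^ 2 + ‖D₂‖ ^ 2 + ‖D₃‖ ^ 2 + ‖D₄‖ ^ 2) := by
        nlinarith [sq_nonneg (‖D₁‖ - ‖D₂‖), sq_nonneg (‖D₃‖ - ‖D₄‖), sq_nonneg (‖D₁‖ + ‖D₂‖ - ‖D₃‖ - ‖D₄‖)]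

/-! ## §2 `SU(2)` level: unit quaternions, conjugation and the adjoint rotation -/

/-- **`imVec` OF A CONJUGATE IS THE ADJOINT ROTATION OF `imVec`**: `imVec q(T·B·T⁻¹) = Ad_T (imVec q(B))`. [cite: Balaban1989LargeFieldI, (1.77) p.194] -/
theorem imVec_su2Quat_conj (T B : SU2) :
    imVec (su2Quat (T * B * T⁻¹)) = adSU2 T (imVec (su2Quat B)) := by
  have hinv : su2Quat T⁻¹ = (su2Quat T)⁻¹ :=
    eq_inv_of_mul_eq_one_right (by rw [← su2Quat_mul, mul_inv_cancel, su2Quat_one])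
  rw [adSU2_apply, imQuat_imVec, su2Quat_mul, su2Quat_mul, hinv]
  have hsplit : su2Quat B = ((su2Quat B).re : ℍ) + (su2Quat B).im := (Quaternion.re_add_im _).symm
  conv_lhs => rw [hsplit]
  rw [mul_add, add_mul, imVec_add]
  have hre : su2Quat T * ((su2Quat B).re : ℍ) * (su2Quat T)⁻¹ = ((su2Quat B).re : ℍ) := by
    rw [← Quaternion.coe_commutes, mul_assoc, mul_inv_cancel₀ (su2Quat_ne_zero T), mul_one]
  rw [hre, imVec_coe, zero_add]

/-- `imVec q(B⁻¹) = −imVec q(B)` (`q(B⁻¹) = star q(B)`). [folklore] -/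
theorem imVec_su2Quat_inv (B : SU2) : imVec (su2Quat B⁻¹) = -imVec (su2Quat B) := by
  rw [T4WilsonLinkAffine.su2Quat_inv]
  ext i
  fin_cases i <;> simp [imVec]

/-- `imVec q(T·B⁻¹·T⁻¹) = −Ad_T (imVec q(B))`. [folklore] -/
theorem imVec_su2Quat_conj_inv (T B : SU2) :
    imVec (su2Quat (T * B⁻¹ * T⁻¹)) = -adSU2 T (imVec (su2Quat B)) := by
  rw [imVec_su2Quat_conj, imVec_su2Quat_inv, map_neg]

/-- `‖q(T·X·T⁻¹) − 1‖ = ‖q(X) − 1‖` (= `dist1`, conjugation invariant). [folklore] -/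
theorem norm_su2Quat_conj_sub_one (T X : SU2) : ‖su2Quat (T * X * T⁻¹) - 1‖ = dist1 X := by
  rw [← dist1_eq_norm_su2Quat_sub_one, GaugeGroup.dist1_conj]

/-! ## §3 Plaquette level: the relative plaquette as four conjugated factors; its chart vector to first order -/

section Plaquette

variable {P : Params} {j : ℕ}

/-- **THE RELATIVE PLAQUETTE IS A PRODUCT OF FOUR CONJUGATED RELATIVE BOND VARIABLES** (exact group identity): with
`B_i := U(ℓ_i)·U₀(ℓ_i)⁻¹` on the four bonds of `p` and the partial transporters `T₁ = U₀(∂p)⁻¹`, `T₂ = T₁·U₀(ℓ₁)`, `T₃ = T₂·U₀(ℓ₂)·U₀(ℓ₃)⁻¹`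
(`T₄ = 1`), `U₀(∂p)⁻¹·U(∂p) = (T₁B₁T₁⁻¹)(T₂B₂T₂⁻¹)(T₃B₃⁻¹T₃⁻¹)B₄⁻¹`. [cite: Balaban1985Variational, (34) p.283] -/
theorem rel_plaqHol_eq_fourFactor (U U₀ : GaugeField P j SU2) (p : Plaq P j) :
    (GaugeField.plaqHol U₀ p)⁻¹ * GaugeField.plaqHol U p =
      ((GaugeField.plaqHol U₀ p)⁻¹ * (U ⟨p.src, p.μ⟩ * (U₀ ⟨p.src, p.μ⟩)⁻¹) * ((GaugeField.plaqHol U₀ p)⁻¹)⁻¹) *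
      ((GaugeField.plaqHol U₀ p)⁻¹ * U₀ ⟨p.src, p.μ⟩ * (U ⟨p.src.shift p.μ, p.ν⟩ * (U₀ ⟨p.src.shift p.μ, p.ν⟩)⁻¹) *
        ((GaugeField.plaqHol U₀ p)⁻¹ * U₀ ⟨p.src, p.μ⟩)⁻¹) *
      ((GaugeField.plaqHol U₀ p)⁻¹ * U₀ ⟨p.src, p.μ⟩ * U₀ ⟨p.src.shift p.μ, p.ν⟩ * (U₀ ⟨p.src.shift p.ν, p.μ⟩)⁻¹ *
        (U ⟨p.src.shift p.ν, p.μ⟩ * (U₀ ⟨p.src.shift p.ν, p.μ⟩)⁻¹)⁻¹ *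
        ((GaugeField.plaqHol U₀ p)⁻¹ * U₀ ⟨p.src, p.μ⟩ * U₀ ⟨p.src.shift p.μ, p.ν⟩ * (U₀ ⟨p.src.shift p.ν, p.μ⟩)⁻¹)⁻¹) *
      (U ⟨p.src, p.ν⟩ * (U₀ ⟨p.src, p.ν⟩)⁻¹)⁻¹ := by
  simp only [GaugeField.plaqHol]
  group

/-- ★ **THE CHART VECTOR OF THE RELATIVE PLAQUETTE TO FIRST ORDER** (the kinematic heart of (T♮)): with `ξ_ℓ := imVec q(U ℓ·(U₀ ℓ)⁻¹)` and the
linear part `L_p(ξ) := Ad_{T₁}ξ_{ℓ₁} + Ad_{T₂}ξ_{ℓ₂} − Ad_{T₃}ξ_{ℓ₃} − ξ_{ℓ₄}`,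
`‖imVec q(U₀(∂p)⁻¹·U(∂p)) − L_p(ξ)‖ ≤ 5·Σ_{i≤4} dist1(U(ℓ_i)·U₀(ℓ_i)⁻¹)²` — no smallness of the pair needed (chord currency).
[cite: Balaban1985Variational, (34) p.283] -/
theorem norm_imVec_rel_sub_lin_le (U U₀ : GaugeField P j SU2) (p : Plaq P j) :
    ‖imVec (su2Quat ((GaugeField.plaqHol U₀ p)⁻¹ * GaugeField.plaqHol U p)) -
        (adSU2 (GaugeField.plaqHol U₀ p)⁻¹ (imVec (su2Quat (U ⟨p.src, p.μ⟩ * (U₀ ⟨p.src, p.μ⟩)⁻¹))) +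
          adSU2 ((GaugeField.plaqHol U₀ p)⁻¹ * U₀ ⟨p.src, p.μ⟩) (imVec (su2Quat (U ⟨p.src.shift p.μ, p.ν⟩ * (U₀ ⟨p.src.shift p.μ, p.ν⟩)⁻¹))) -
          adSU2 ((GaugeField.plaqHol U₀ p)⁻¹ * U₀ ⟨p.src, p.μ⟩ * U₀ ⟨p.src.shift p.μ, p.ν⟩ * (U₀ ⟨p.src.shift p.ν, p.μ⟩)⁻¹)
            (imVec (su2Quat (U ⟨p.src.shift p.ν, p.μ⟩ * (U₀ ⟨p.src.shift p.ν, p.μ⟩)⁻¹))) -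
          imVec (su2Quat (U ⟨p.src, p.ν⟩ * (U₀ ⟨p.src, p.ν⟩)⁻¹)))‖ ≤
      5 * (dist1 (U ⟨p.src, p.μ⟩ * (U₀ ⟨p.src, p.μ⟩)⁻¹) ^ 2 + dist1 (U ⟨p.src.shift p.μ, p.ν⟩ * (U₀ ⟨p.src.shift p.μ, p.ν⟩)⁻¹) ^ 2 +
        dist1 (U ⟨p.src.shift p.ν, p.μ⟩ * (U₀ ⟨p.src.shift p.ν, p.μ⟩)⁻¹) ^ 2 + dist1 (U ⟨p.src, p.ν⟩ * (U₀ ⟨p.src, p.ν⟩)⁻¹) ^ 2) := by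
  -- names for the transporters and relative bond variables
  set P₀ := GaugeField.plaqHol U₀ p with hP₀
  set B₁ := U ⟨p.src, p.μ⟩ * (U₀ ⟨p.src, p.μ⟩)⁻¹ with hB₁
  set B₂ := U ⟨p.src.shift p.μ, p.ν⟩ * (U₀ ⟨p.src.shift p.μ, p.ν⟩)⁻¹ with hB₂
  set B₃ := U ⟨p.src.shift p.ν, p.μ⟩ * (U₀ ⟨p.src.shift p.ν, p.μ⟩)⁻¹ with hB₃
  set B₄ := U ⟨p.src, p.ν⟩ * (U₀ ⟨p.src, p.ν⟩)⁻¹ with hB₄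
  set T₁ := P₀⁻¹ with hT₁
  set T₂ := P₀⁻¹ * U₀ ⟨p.src, p.μ⟩ with hT₂
  set T₃ := P₀⁻¹ * U₀ ⟨p.src, p.μ⟩ * U₀ ⟨p.src.shift p.μ, p.ν⟩ * (U₀ ⟨p.src.shift p.ν, p.μ⟩)⁻¹ with hT₃
  have hE : P₀⁻¹ * GaugeField.plaqHol U p = (T₁ * B₁ * T₁⁻¹) * (T₂ * B₂ * T₂⁻¹) * (T₃ * B₃⁻¹ * T₃⁻¹) * B₄⁻¹ := by
    rw [hP₀, hT₁, hT₂, hT₃, hB₁, hB₂, hB₃, hB₄]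
    exact rel_plaqHol_eq_fourFactor U U₀ p
  rw [hE, su2Quat_mul, su2Quat_mul, su2Quat_mul]
  set F₁ := su2Quat (T₁ * B₁ * T₁⁻¹) with hF₁
  set F₂ := su2Quat (T₂ * B₂ * T₂⁻¹) with hF₂
  set F₃ := su2Quat (T₃ * B₃⁻¹ * T₃⁻¹) with hF₃
  set F₄ := su2Quat B₄⁻¹ with hF₄
  have hsubv : ∀ x y : ℍ, imVec (x - y) = imVec x - imVec y := fun x y => map_sub imVecL x y
  -- the linear part is `Σ imVec F_i = imVec (Σ (F_i − 1))`
  have h1 : imVec F₁ = adSU2 T₁ (imVec (su2Quat B₁)) := by rw [hF₁, imVec_su2Quat_conj]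
  have h2 : imVec F₂ = adSU2 T₂ (imVec (su2Quat B₂)) := by rw [hF₂, imVec_su2Quat_conj]
  have h3 : imVec F₃ = -adSU2 T₃ (imVec (su2Quat B₃)) := by rw [hF₃, imVec_su2Quat_conj_inv]
  have h4 : imVec F₄ = -imVec (su2Quat B₄) := by rw [hF₄, imVec_su2Quat_inv]
  have hlin : adSU2 T₁ (imVec (su2Quat B₁)) + adSU2 T₂ (imVec (su2Quat B₂)) - adSU2 T₃ (imVec (su2Quat B₃)) - imVec (su2Quat B₄) =
      imVec ((F₁ - 1) + (F₂ - 1) + (F₃ - 1) + (F₄ - 1)) := by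
    rw [imVec_add, imVec_add, imVec_add, hsubv, hsubv, hsubv, hsubv, imVec_one, h1, h2, h3, h4]
    simp only [sub_zero]
    abel
  have hsub : imVec (F₁ * F₂ * F₃ * F₄) - imVec ((F₁ - 1) + (F₂ - 1) + (F₃ - 1) + (F₄ - 1)) =
      imVec (F₁ * F₂ * F₃ * F₄ - 1 - ((F₁ - 1) + (F₂ - 1) + (F₃ - 1) + (F₄ - 1))) := by
    rw [hsubv, hsubv, imVec_one, sub_zero]
  rw [hlin, hsub]
  have hnorm : ∀ q : ℍ, ‖imVec q‖ ≤ ‖q‖ := fun q => by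
    have h : ‖q‖ ^ 2 = q.re ^ 2 + q.imI ^ 2 + q.imJ ^ 2 + q.imK ^ 2 := by
      rw [sq, ← Quaternion.normSq_eq_norm_mul_self, Quaternion.normSq_def']
    have h1 : ‖imVec q‖ ^ 2 ≤ ‖q‖ ^ 2 := by rw [norm_imVec_sq, h]; nlinarith [sq_nonneg q.re]
    exact (pow_le_pow_iff_left₀ (norm_nonneg _) (norm_nonneg _) two_ne_zero).mp h1
  refine (hnorm _).trans ?_
  have hd₁ : ‖F₁ - 1‖ = dist1 B₁ := by rw [hF₁, norm_su2Quat_conj_sub_one]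
  have hd₂ : ‖F₂ - 1‖ = dist1 B₂ := by rw [hF₂, norm_su2Quat_conj_sub_one]
  have hd₃ : ‖F₃ - 1‖ = dist1 B₃ := by rw [hF₃, norm_su2Quat_conj_sub_one, GaugeGroup.dist1_inv]
  have hd₄ : ‖F₄ - 1‖ = dist1 B₄ := by rw [hF₄, ← dist1_eq_norm_su2Quat_sub_one, GaugeGroup.dist1_inv]
  have key := norm_fourFactor_rem_le F₁ F₂ F₃ F₄ (hd₁ ▸ CovariantDischargeDirectionNet.dist1_le_two B₁)
    (hd₂ ▸ CovariantDischargeDirectionNet.dist1_le_two B₂) (hd₃ ▸ CovariantDischargeDirectionNet.dist1_le_two B₃)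
    (hd₄ ▸ CovariantDischargeDirectionNet.dist1_le_two B₄)
  rw [hd₁, hd₂, hd₃, hd₄] at key
  exact key

/-- ★ **THE PAIRING OF ONE PLAQUETTE TO FIRST ORDER**: `|⟪a_p, imVec q(E_p)⟫ − ⟪a_p, L_p(ξ)⟫| ≤ 5·θ₀·Σ_{i≤4} dist1(B_i)²` when `dist1 U₀(∂p) ≤ θ₀`
(`‖a_p‖ = ‖imVec q(U₀∂p)‖ ≤ dist1 U₀∂p`, ✓`norm_imVec_le_dist1`). [cite: Balaban1985Variational, (34) p.283] -/
theorem abs_inner_rel_sub_inner_lin_le (U U₀ : GaugeField P j SU2) (p : Plaq P j) {θ₀ : ℝ}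
    (hθ : dist1 (GaugeField.plaqHol U₀ p) ≤ θ₀) :
    |inner ℝ (imVec (su2Quat (GaugeField.plaqHol U₀ p))) (imVec (su2Quat ((GaugeField.plaqHol U₀ p)⁻¹ * GaugeField.plaqHol U p))) -
      inner ℝ (imVec (su2Quat (GaugeField.plaqHol U₀ p)))
        (adSU2 (GaugeField.plaqHol U₀ p)⁻¹ (imVec (su2Quat (U ⟨p.src, p.μ⟩ * (U₀ ⟨p.src, p.μ⟩)⁻¹))) +
          adSU2 ((GaugeField.plaqHol U₀ p)⁻¹ * U₀ ⟨p.src, p.μ⟩) (imVec (su2Quat (U ⟨p.src.shift p.μ, p.ν⟩ * (U₀ ⟨p.src.shift p.μ, p.ν⟩)⁻¹))) -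
          adSU2 ((GaugeField.plaqHol U₀ p)⁻¹ * U₀ ⟨p.src, p.μ⟩ * U₀ ⟨p.src.shift p.μ, p.ν⟩ * (U₀ ⟨p.src.shift p.ν, p.μ⟩)⁻¹)
            (imVec (su2Quat (U ⟨p.src.shift p.ν, p.μ⟩ * (U₀ ⟨p.src.shift p.ν, p.μ⟩)⁻¹))) -
          imVec (su2Quat (U ⟨p.src, p.ν⟩ * (U₀ ⟨p.src, p.ν⟩)⁻¹)))| ≤
      5 * θ₀ * (dist1 (U ⟨p.src, p.μ⟩ * (U₀ ⟨p.src, p.μ⟩)⁻¹) ^ 2 + dist1 (U ⟨p.src.shift p.μ, p.ν⟩ * (U₀ ⟨p.src.shift p.μ, p.ν⟩)⁻¹) ^ 2 +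
        dist1 (U ⟨p.src.shift p.ν, p.μ⟩ * (U₀ ⟨p.src.shift p.ν, p.μ⟩)⁻¹) ^ 2 + dist1 (U ⟨p.src, p.ν⟩ * (U₀ ⟨p.src, p.ν⟩)⁻¹) ^ 2) := by
  rw [← inner_sub_right]
  refine (abs_real_inner_le_norm _ _).trans ?_
  have ha : ‖imVec (su2Quat (GaugeField.plaqHol U₀ p))‖ ≤ θ₀ :=
    (CovariantDischargeDirectionNet.norm_imVec_le_dist1 _).trans hθ
  have hr := norm_imVec_rel_sub_lin_le U U₀ p
  have hθ0 : 0 ≤ θ₀ := (GaugeGroup.dist1_nonneg _).trans hθ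
  calc _ ≤ θ₀ * (5 * (dist1 (U ⟨p.src, p.μ⟩ * (U₀ ⟨p.src, p.μ⟩)⁻¹) ^ 2 + dist1 (U ⟨p.src.shift p.μ, p.ν⟩ * (U₀ ⟨p.src.shift p.μ, p.ν⟩)⁻¹) ^ 2 +
        dist1 (U ⟨p.src.shift p.ν, p.μ⟩ * (U₀ ⟨p.src.shift p.ν, p.μ⟩)⁻¹) ^ 2 + dist1 (U ⟨p.src, p.ν⟩ * (U₀ ⟨p.src, p.ν⟩)⁻¹) ^ 2)) :=
        mul_le_mul ha hr (norm_nonneg _) hθ0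
    _ = _ := by ring

end Plaquette

/-! ## §4 Slot double counting: each of the four bond slots of a plaquette has fibres of size `≤ d` -/

section Counting

variable {P : Params} {j : ℕ}

/-- **FIBRE DOUBLE COUNTING**: `Σ_a f(g a) ≤ M·Σ_b f b` for `f ≥ 0` when every fibre of `g` has at most `M` points. [folklore] -/
theorem sum_comp_le_of_card_fibre_le {α β : Type*} [Fintype α] [Fintype β] [DecidableEq β] (g : α → β) (f : β → ℝ)
    (hf : ∀ b, 0 ≤ f b) (M : ℕ) (hM : ∀ b, #{a ∈ (univ : Finset α) | g a = b} ≤ M) :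
    ∑ a, f (g a) ≤ M * ∑ b, f b := by
  rw [← sum_fiberwise univ g (fun a => f (g a)), mul_sum]
  refine sum_le_sum fun b _ => ?_
  calc ∑ a ∈ univ.filter (fun a => g a = b), f (g a) = ∑ a ∈ univ.filter (fun a => g a = b), f b :=
        sum_congr rfl fun a ha => by rw [(mem_filter.mp ha).2]
    _ = #{a ∈ (univ : Finset α) | g a = b} • f b := sum_const _
    _ ≤ M * f b := by
        rw [nsmul_eq_mul]
        exact mul_le_mul_of_nonneg_right (by exact_mod_cast hM b) (hf b)

/-- Slot 1 (`⟨x, e_μ⟩`): fibres inject into the second direction `ν`. [folklore] -/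
theorem card_slot₁_le [DecidableEq (PBond P j)] (ℓ : PBond P j) : #{p ∈ (univ : Finset (Plaq P j)) | (⟨p.src, p.μ⟩ : PBond P j) = ℓ} ≤ P.d := by
  obtain ⟨x, κ⟩ := ℓ
  calc #{p ∈ (univ : Finset (Plaq P j)) | (⟨p.src, p.μ⟩ : PBond P j) = ⟨x, κ⟩} ≤ #(univ : Finset (Fin P.d)) := by
        refine card_le_card_of_injOn (fun p => p.ν) (fun p _ => mem_coe.mpr (mem_univ _)) ?_
        rintro ⟨s, μ, ν, h⟩ hp ⟨s', μ', ν', h'⟩ hp' hν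
        simp only [coe_filter, mem_univ, true_and, Set.mem_setOf_eq, PBond.mk.injEq] at hp hp' hν
        obtain ⟨h1, h2⟩ := hp
        obtain ⟨h1', h2'⟩ := hp'
        subst h1 h2 hν
        cases h1'
        cases h2'
        rfl
    _ = P.d := by simp

/-- Slot 2 (`⟨x + e_μ, e_ν⟩`): fibres inject into the first direction `μ` (one lattice step is injective). [folklore] -/
theorem card_slot₂_le [DecidableEq (PBond P j)] (ℓ : PBond P j) : #{p ∈ (univ : Finset (Plaq P j)) | (⟨p.src.shift p.μ, p.ν⟩ : PBond P j) = ℓ} ≤ P.d := by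
  obtain ⟨x, κ⟩ := ℓ
  calc #{p ∈ (univ : Finset (Plaq P j)) | (⟨p.src.shift p.μ, p.ν⟩ : PBond P j) = ⟨x, κ⟩} ≤ #(univ : Finset (Fin P.d)) := by
        refine card_le_card_of_injOn (fun p => p.μ) (fun p _ => mem_coe.mpr (mem_univ _)) ?_
        rintro ⟨s, μ, ν, h⟩ hp ⟨s', μ', ν', h'⟩ hp' hμ
        simp only [coe_filter, mem_univ, true_and, Set.mem_setOf_eq, PBond.mk.injEq] at hp hp' hμ
        obtain ⟨h1, h2⟩ := hp
        obtain ⟨h1', h2'⟩ := hp'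
        subst hμ h2
        cases h2'
        have hss : s = s' := by
          have hsh : s.shift μ = s'.shift μ := h1.trans h1'.symm
          funext κ
          have hκ := congrFun hsh κ
          by_cases hk : κ = μ
          · subst hk; simpa [Site.shift] using hκ
          · simpa [Site.shift, Function.update_of_ne hk] using hκ
        subst hss
        rfl
    _ = P.d := by simp

/-- Slot 3 (`⟨x + e_ν, e_μ⟩`): fibres inject into the second direction `ν`. [folklore] -/
theorem card_slot₃_le [DecidableEq (PBond P j)] (ℓ : PBond P j) : #{p ∈ (univ : Finset (Plaq P j)) | (⟨p.src.shift p.ν, p.μ⟩ : PBond P j) = ℓ} ≤ P.d := by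
  obtain ⟨x, κ⟩ := ℓ
  calc #{p ∈ (univ : Finset (Plaq P j)) | (⟨p.src.shift p.ν, p.μ⟩ : PBond P j) = ⟨x, κ⟩} ≤ #(univ : Finset (Fin P.d)) := by
        refine card_le_card_of_injOn (fun p => p.ν) (fun p _ => mem_coe.mpr (mem_univ _)) ?_
        rintro ⟨s, μ, ν, h⟩ hp ⟨s', μ', ν', h'⟩ hp' hν
        simp only [coe_filter, mem_univ, true_and, Set.mem_setOf_eq, PBond.mk.injEq] at hp hp' hν
        obtain ⟨h1, h2⟩ := hp
        obtain ⟨h1', h2'⟩ := hp'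
        subst hν h2
        cases h2'
        have hss : s = s' := by
          have hsh : s.shift ν = s'.shift ν := h1.trans h1'.symm
          funext κ
          have hκ := congrFun hsh κ
          by_cases hk : κ = ν
          · subst hk; simpa [Site.shift] using hκ
          · simpa [Site.shift, Function.update_of_ne hk] using hκ
        subst hss
        rfl
    _ = P.d := by simp

/-- Slot 4 (`⟨x, e_ν⟩`): fibres inject into the first direction `μ`. [folklore] -/
theorem card_slot₄_le [DecidableEq (PBond P j)] (ℓ : PBond P j) : #{p ∈ (univ : Finset (Plaq P j)) | (⟨p.src, p.ν⟩ : PBond P j) = ℓ} ≤ P.d := by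
  obtain ⟨x, κ⟩ := ℓ
  calc #{p ∈ (univ : Finset (Plaq P j)) | (⟨p.src, p.ν⟩ : PBond P j) = ⟨x, κ⟩} ≤ #(univ : Finset (Fin P.d)) := by
        refine card_le_card_of_injOn (fun p => p.μ) (fun p _ => mem_coe.mpr (mem_univ _)) ?_
        rintro ⟨s, μ, ν, h⟩ hp ⟨s', μ', ν', h'⟩ hp' hμ
        simp only [coe_filter, mem_univ, true_and, Set.mem_setOf_eq, PBond.mk.injEq] at hp hp' hμ
        obtain ⟨h1, h2⟩ := hp
        obtain ⟨h1', h2'⟩ := hp'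
        subst h1 h2 hμ
        cases h1'
        cases h2'
        rfl
    _ = P.d := by simp

/-- ★ **THE FOUR SLOT SUMS AGAINST ONE BOND SUM**: `Σ_p Σ_{i≤4} f(ℓ_i(p)) ≤ 4d·Σ_ℓ f(ℓ)` for `f ≥ 0`. [folklore] -/
theorem sum_slots_le [DecidableEq (PBond P j)] (f : PBond P j → ℝ) (hf : ∀ ℓ, 0 ≤ f ℓ) :
    ∑ p : Plaq P j, (f ⟨p.src, p.μ⟩ + f ⟨p.src.shift p.μ, p.ν⟩ + f ⟨p.src.shift p.ν, p.μ⟩ + f ⟨p.src, p.ν⟩) ≤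
      4 * P.d * ∑ ℓ : PBond P j, f ℓ := by
  rw [sum_add_distrib, sum_add_distrib, sum_add_distrib]
  have h1 := sum_comp_le_of_card_fibre_le (fun p : Plaq P j => (⟨p.src, p.μ⟩ : PBond P j)) f hf P.d card_slot₁_le
  have h2 := sum_comp_le_of_card_fibre_le (fun p : Plaq P j => (⟨p.src.shift p.μ, p.ν⟩ : PBond P j)) f hf P.d card_slot₂_le
  have h3 := sum_comp_le_of_card_fibre_le (fun p : Plaq P j => (⟨p.src.shift p.ν, p.μ⟩ : PBond P j)) f hf P.d card_slot₃_le
  have h4 := sum_comp_le_of_card_fibre_le (fun p : Plaq P j => (⟨p.src, p.ν⟩ : PBond P j)) f hf P.d card_slot₄_le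
  linarith

end Counting

/-! ## §5 (T♮) — the tangent split of the pairing, field level -/

section Field

variable {P : Params} {j : ℕ}

/-- ★★★ **(T♮) THE TANGENT SPLIT OF THE PAIRING, PROVED**: for ANY two configurations `U, U₀` on one lattice with `dist1 U₀(∂p) ≤ θ₀`,
`|LIN(U;U₀) − DA(U₀)[ξ(U,U₀)]| ≤ 20·d·θ₀·Σ_ℓ dist1(U ℓ·(U₀ ℓ)⁻¹)²`, where `LIN = Σ_p ⟪imVec q(U₀∂p), imVec q(E_p)⟫` is the pairing of
✓`…S2BetaExcessSplit.wilsonAction4_sub_eq`, `ξ_ℓ = imVec q(U ℓ·(U₀ ℓ)⁻¹)` the right-invariant chart vector, and `DA(U₀)` the EXPLICIT first variation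
`ζ ↦ Σ_p ⟪imVec q(U₀∂p), Ad_{T₁(p)}ζ_{ℓ₁} + Ad_{T₂(p)}ζ_{ℓ₂} − Ad_{T₃(p)}ζ_{ℓ₃} − ζ_{ℓ₄}⟫` (partial transporters of §3) — applied here to `ζ := ξ`.
Any `Params`, any level, no smallness of the pair; the `θ₀` weight is what makes the remainder `θ₀ × (second order)` (UV3-NODE §75.2 (b), §75.8 (3)).
[cite: Balaban1985Variational, (34) p.283, Thm 1 (9) p.279] -/
theorem tangentSplit (U U₀ : GaugeField P j SU2) {θ₀ : ℝ} (hθ0 : 0 ≤ θ₀) (hθ : ∀ p : Plaq P j, dist1 (GaugeField.plaqHol U₀ p) ≤ θ₀) :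
    |(∑ p : Plaq P j, inner ℝ (imVec (su2Quat (GaugeField.plaqHol U₀ p)))
        (imVec (su2Quat ((GaugeField.plaqHol U₀ p)⁻¹ * GaugeField.plaqHol U p)))) -
      (fun ζ : PBond P j → EuclideanSpace ℝ (Fin 3) => ∑ p : Plaq P j, inner ℝ (imVec (su2Quat (GaugeField.plaqHol U₀ p)))
        (adSU2 (GaugeField.plaqHol U₀ p)⁻¹ (ζ ⟨p.src, p.μ⟩) + adSU2 ((GaugeField.plaqHol U₀ p)⁻¹ * U₀ ⟨p.src, p.μ⟩) (ζ ⟨p.src.shift p.μ, p.ν⟩) -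
          adSU2 ((GaugeField.plaqHol U₀ p)⁻¹ * U₀ ⟨p.src, p.μ⟩ * U₀ ⟨p.src.shift p.μ, p.ν⟩ * (U₀ ⟨p.src.shift p.ν, p.μ⟩)⁻¹) (ζ ⟨p.src.shift p.ν, p.μ⟩) -
          ζ ⟨p.src, p.ν⟩))
        (fun ℓ => imVec (su2Quat (U ℓ * (U₀ ℓ)⁻¹)))| ≤
      20 * P.d * θ₀ * ∑ ℓ : PBond P j, dist1 (U ℓ * (U₀ ℓ)⁻¹) ^ 2 := by
  classical
  beta_reduce
  rw [← sum_sub_distrib]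
  refine ((abs_sum_le_sum_abs _ _).trans (sum_le_sum fun p _ => abs_inner_rel_sub_inner_lin_le U U₀ p (hθ p))).trans ?_
  rw [← mul_sum]
  have hs := sum_slots_le (fun ℓ : PBond P j => dist1 (U ℓ * (U₀ ℓ)⁻¹) ^ 2) fun _ => sq_nonneg _
  calc _ ≤ 5 * θ₀ * (4 * P.d * ∑ ℓ : PBond P j, dist1 (U ℓ * (U₀ ℓ)⁻¹) ^ 2) := mul_le_mul_of_nonneg_left hs (by positivity)
    _ = 20 * P.d * θ₀ * ∑ ℓ : PBond P j, dist1 (U ℓ * (U₀ ℓ)⁻¹) ^ 2 := by ring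

end Field

end Summit.QuantumFields.YangMills.Theorems.FluctuationComparisonRegPrIntLS2BetaPairingTangentSplit

end
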